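import Summits.HubbardSuperconductivity.HubbardSuperconductivity.Theorems.AnisotropyChordTransferFibre3FinXC2Cell

/-!
# Route `AnisotropyChord` / H0 rotor rung: FIN mid-`L` — the λ-cell cover of the COMBINED XBC2 certificate: rows `N₁` and C per `L`

Packaging of `…Fibre3FinXC2Cell.xbc2_cell_sound` over a list of cells `(pᵢ, cᵢ, bnᵢ)` (common denominator `bd`), XBC2 analogue of
g5's `…FinXCCover` (same `cellsAllC` / `cover_allC` / `CellConclusion`): ★ `xbc2_cellAny_sound`, ★ `xbc2_of_check`,
★★ `trialGapAbs_of_xbcCheck2` and ★★ `offPoleTailAbs_of_xbcCheck2` (`OffPoleTailAbs L Δ (bmax/bd)` for any `bmax` above every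
cell's `bn`, via p1's `KT2Assembly.offPoleTailAbs_of_brackets`).
Prover seat `hubbard-h0-rotor-p3` g6; helper for piece A = stmt-HubbardSuperconductivity-23918 of rung 19089 (`--supports`, helper
class).  WHAT THIS IS NOT: nothing here proves superconductivity in the Hubbard model (rotor TARGET as worded stays FALSE, g15 verdict);
two hypotheses (rows `N₁` and C per `L`) of ONE conditional reduction (`gm3_allL`).  Tree imports only; no sorry, no new axioms.
-/

set_option linter.dupNamespace false
set_option autoImplicit false

namespace Summit.HubbardSuperconductivity.HubbardSuperconductivity.Theorems.AnisotropyChord.Transfer.Fibre3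

namespace FinXB

open scoped BigOperators
open Finset Hole2 FinCell

/-- one cell of the combined XBC2 certificate. [folklore] -/
theorem xbc2_cellAny_sound (L : ℕ) [NeZero L] (hL : 5 ≤ L) {d1 : ℚ} {bd : ℕ} {Δ lam2 : ℝ} (hΔ0 : 0 < Δ)
    (hΔd : Δ ≤ (d1 : ℝ)) (hΔ1 : Δ < 1) {f : Tor L → ℝ} (hf : IsGroundTwoMagnon L Δ lam2 f) {la lb : ℤ}
    (hla : (la : ℝ) ≤ lam2 * ((D : ℤ) : ℝ)) (hlb : lam2 * ((D : ℤ) : ℝ) ≤ (lb : ℝ)) {cb : ℚ × ℕ}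
    (hok : xbcCellAny2 L d1 bd la lb cb = true) : CellConclusion L Δ lam2 f cb.1 cb.2 bd := by
  have hL3 : 3 ≤ L := by omega
  have hD := D_pos
  have hlam : 0 < lam2 := lam2_pos L hL3 hΔ1 hf.1
  have hΔe : Δ = deltaOfLam L lam2 := ground_delta_eq L hL hΔ0.le hΔ1 hf
  unfold xbcCellAny2 xbcCellAnyT2 at hok
  simp only [Bool.or_eq_true, Bool.and_eq_true, decide_eq_true_eq] at hok
  rcases hok with (⟨⟨hpos, hnum⟩, hG0⟩ | ⟨hgc, hvac⟩) | hcert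
  · exact (vacuous_of_num_neg (L := L) hL3 hlam hla hlb hpos hnum hG0 hΔ0 hΔ1 hΔe).elim
  · exfalso
    have hmd := mem_delta_cell L hL3 hlam hla hlb hgc
    rw [← hΔe] at hmd
    obtain ⟨hlo, hhi⟩ := hmd
    rcases hvac with hneg | hbig
    · have : ((((deltaIv L la lb).2 : ℤ)) : ℝ) < 0 := by exact_mod_cast hneg
      nlinarith
    · have hbig' : (d1 : ℝ) * ((D : ℤ) : ℝ) < ((((deltaIv L la lb).1 : ℤ)) : ℝ) := by
        have e : (((D : ℚ)) : ℝ) = ((D : ℤ) : ℝ) := by norm_cast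
        rw [← e]; exact_mod_cast hbig
      nlinarith
  · exact xbc2_cell_sound hL hΔ0 hΔ1 hf hla hlb hcert

/-- ★ from the per-`L` combined XBC2 certificate: every ground profile at `0 < Δ ≤ Δ₁`, `Δ < 1` satisfies the conclusions of its
cell. [folklore] -/
theorem xbc2_of_check (L : ℕ) [NeZero L] (hL : 7 ≤ L) {d1 : ℚ} {bd : ℕ} {cells : List (ℤ × ℚ × ℕ)}
    (h : xbcCheck2 L d1 bd cells = true) {Δ : ℝ} (hΔ0 : 0 < Δ) (hΔd : Δ ≤ (d1 : ℝ)) (hΔ1 : Δ < 1) :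
    ∀ lam2 : ℝ, ∀ f : Tor L → ℝ, IsGroundTwoMagnon L Δ lam2 f →
      ∃ cb ∈ cells.map Prod.snd, CellConclusion L Δ lam2 f cb.1 cb.2 bd := by
  refine forall_ground_of_window_7 L hL hΔ0.le hΔ1 _ ?_
  intro lam2 f hf hlam0 hlamle
  have hD := D_pos
  unfold xbcCheck2 at h
  simp only [Bool.and_eq_true, decide_eq_true_eq] at h
  obtain ⟨⟨⟨⟨hhead, hlen⟩, htop⟩, _⟩, hok⟩ := h
  obtain ⟨a, b, rest, hcells⟩ : ∃ a b : ℤ × ℚ × ℕ, ∃ rest : List (ℤ × ℚ × ℕ), cells = a :: b :: rest := by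
    match cells, hlen with
    | a :: b :: rest, _ => exact ⟨a, b, rest, rfl⟩
  subst hcells
  have ha0 : a.1 = 0 := by simpa using hhead
  set x : ℝ := lam2 * ((D : ℤ) : ℝ) with hx
  have hx0 : (a.1 : ℝ) ≤ x := by rw [ha0, hx]; push_cast; positivity
  have hxtop : x ≤ ((cellsLastC (a :: b :: rest) : ℤ) : ℝ) :=
    (lam_mul_D_le_lamTop L (by omega) hlamle).trans (by exact_mod_cast htop)
  obtain ⟨c, d, q, hcell, hcx, hxd, hq⟩ := cover_allC (xbcCellAny2 L d1 bd) rest a b x hok hx0 hxtop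
  exact ⟨q, hq, xbc2_cellAny_sound L (by omega) hΔ0 hΔd hΔ1 hf hcx hxd hcell⟩

/-- ★★ ROW `N₁` from the combined XBC2 certificate (uniform constant). [folklore] -/
theorem trialGapAbs_of_xbcCheck2 (L : ℕ) [NeZero L] (hL : 7 ≤ L) {d1 : ℚ} {bd : ℕ} {cells : List (ℤ × ℚ × ℕ)}
    (h : xbcCheck2 L d1 bd cells = true) {c : ℚ} (hc : ∀ cb ∈ cells.map Prod.snd, c ≤ cb.1)
    {Δ : ℝ} (hΔ0 : 0 < Δ) (hΔd : Δ ≤ (d1 : ℝ)) (hΔ1 : Δ < 1) : TrialGapAbs L Δ c := by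
  intro lam2 f hf
  obtain ⟨cb, hcb, hconc, -⟩ := xbc2_of_check L hL h hΔ0 hΔd hΔ1 lam2 f hf
  have hU : 0 < Uunit L Δ f := by
    unfold Uunit
    have hT := Tplus_pos L (by omega) hΔ1 hf
    have hLpos : (0 : ℝ) < L := by exact_mod_cast (show 0 < L by omega)
    positivity
  have hcq : ((c : ℚ) : ℝ) ≤ ((cb.1 : ℚ) : ℝ) := by exact_mod_cast hc cb hcb
  exact (mul_le_mul_of_nonneg_right hcq hU.le).trans hconc

/-- ★★ ROW C (KT-2b″) from the combined XBC2 certificate: `OffPoleTailAbs L Δ (bmax/bd)` for any `bmax` above every cell's `bn`.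
[folklore] -/
theorem offPoleTailAbs_of_xbcCheck2 (L : ℕ) [NeZero L] (hL : 7 ≤ L) {d1 : ℚ} {bd : ℕ} {cells : List (ℤ × ℚ × ℕ)}
    (h : xbcCheck2 L d1 bd cells = true) {bmax : ℕ} (hb : ∀ cb ∈ cells.map Prod.snd, cb.2 ≤ bmax)
    {Δ : ℝ} (hΔ0 : 0 < Δ) (hΔd : Δ ≤ (d1 : ℝ)) (hΔ1 : Δ < 1) : OffPoleTailAbs L Δ ((bmax : ℝ) / bd) := by
  have hbd : 0 < bd := by
    unfold xbcCheck2 at h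
    simp only [Bool.and_eq_true, decide_eq_true_eq] at h
    exact h.1.2
  refine KT2Assembly.offPoleTailAbs_of_brackets L (by omega) hΔ1 (by positivity) ?_
  intro lam2 f hf
  obtain ⟨cb, hcb, -, Chi, Nhi, Plo, Llo, Tlo, Thi, hC, hN, hP, hLo, hTlo, hThi, hT2, hTlo0, hineq⟩ :=
    xbc2_of_check L hL h hΔ0 hΔd hΔ1 lam2 f hf
  refine ⟨Chi, Nhi, Plo, Llo, Tlo, Thi, hC, hN, hP, hLo, hTlo, hThi, hT2, hTlo0, hineq.trans ?_⟩
  have hlam : 0 < lam2 := lam2_pos L (by omega) hΔ1 hf.1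
  have hLpos : (0 : ℝ) < L := by exact_mod_cast (show 0 < L by omega)
  have hbdR : (0 : ℝ) < bd := by exact_mod_cast hbd
  have hbb : (cb.2 : ℝ) / bd ≤ (bmax : ℝ) / bd := by
    have : (cb.2 : ℝ) ≤ bmax := by exact_mod_cast hb cb hcb
    exact div_le_div_of_nonneg_right this hbdR.le
  have hrest : 0 ≤ ((L : ℝ) ^ 2 * lam2 / 4) * (2 * eps1 L - Thi) * (3 * ((L : ℝ) ^ 2) ^ 2 * Tlo) := by
    have h1 : 0 ≤ 2 * eps1 L - Thi := by linarith
    positivity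
  have := mul_le_mul_of_nonneg_right hbb hrest
  linarith [this]

end FinXB

end Summit.HubbardSuperconductivity.HubbardSuperconductivity.Theorems.AnisotropyChord.Transfer.Fibre3
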